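import Summits.ABC.IUTFork.Cor312StatementPilotNounsAdm
import Summits.ABC.IUTFork.Cor312EdgeYamashita
import Summits.ABC.IUTFork.Cor312ReadingIso
import HarnessLib

/-!
# [IUTchIII] Cor. 3.12 — Reading 4 (Yamashita, containment up to isomorphism) at the nouns of a setting IS
# `Cor312Vol.IsoContainment` of `Cor312ReadingIso` (dictionary; sequel of `Cor312StatementPilotNounsAdm`)

PROOF-ONLY support file of the abc-iut cell (wave-5 prover seat abc-iut-w5-d235, gen 2; Cor. 3.12 cone kernel-DAG
bookkeeping). TAKES NO SIDE on [IUTchIII] Cor. 3.12; no `def`, no `Prop` fact.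

`Cor312StatementPilotNounsAdm` identified, at the nouns `P.toPilotNouns` of a `Cor312.Setting P` with abc-iut-c312-6's
`BridgeHyps`, the apex's component licences (skel's `QSubHull` / `QIsImage` / `RepresentedVol` of the component containers
`toCor312Setting`) with the adjudication's readings R2 / R3 / R1 over the setting. THIS FILE adds READING 4 — Yamashita's
«contains a region which is isomorphic (not equal) to the region determined by the q-pilot objects» read at VOLUME level
(G. Yamashita, *A proof of the abc conjecture after Mochizuki*, Cor. 13.13 proof p. 360 ll. 30–40; skel XVIII's
`Cor312Setting.QCongruentSubHull`, `Cor312EdgeYamashita.lean`) — and identifies it, component by component, with TEAM A's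
setting-level reading of record `Cor312Vol.IsoContainment` (`Cor312ReadingIso.lean`) (abc-iut-c312-9, ADJUDICATION-SPEC §1 «R4, weakest
printed rendering»): `isoContainment_iff_qCongruentSubHull_toPilotNouns`. So all four readings of the disputed (xi-f)
passage that the tree types at the COMPONENT-CONTAINER level (apex side) and at the SETTING level (adjudication side)
are now one object each BY NAME. Dictionary only; nothing is asserted. [claim: Mochizuki2012, status: disputed] for the
quoted readings; [cite: Yamashita2024IUTSurvey, Cor. 13.13 proof p. 360 ll. 30–40].
-/

noncomputable section

namespace Summit.ABC.IUTFork.Cor312.Setting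

open Thm311 Cor312Vol Literature.IUT.LogThetaLattice

variable {T : ThetaIndex} {S : LatticeSituation T} {P : Setting S.toSituation}

/-- **Reading 4 at a component = one component of `IsoContainment`**: for the nouns of a setting with the bridge
hypotheses, skel's `QCongruentSubHull` of the component container at `(j, v_ℚ)` says: some admissible sub-region of
`^{n,∘}𝒰_{j,v_ℚ}` has log-volume `μ^log(q-region) = qLocal j v_ℚ`. [claim: Mochizuki2012, status: disputed] -/
theorem qCongruentSubHull_toPilotNouns_iff (H : BridgeHyps P) (m : ℤ) (j : T.LabelStar) (vQ : T.VQ) :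
    (P.toPilotNouns.toCor312Setting P.n m j vQ (componentAdm_toPilotNouns_of_bridgeHyps H m j vQ)).QCongruentSubHull ↔
      ∃ R' : Set (S.L.Packet j.1 vQ), R' ⊆ P.thetaHull j.1 vQ ∧ (S.D P.n).Adm j.1 vQ R' ∧
        (S.D P.n).logvol j.1 vQ R' = P.qLocal j.1 vQ := by
  have hU : (P.toPilotNouns.toCor312Setting P.n m j vQ (componentAdm_toPilotNouns_of_bridgeHyps H m j vQ)).Uhol =
      P.thetaHull j.1 vQ := by
    show P.toPilotNouns.hull P.n j.1 vQ (⋃ R : P.toPilotNouns.possibleImages P.n m j vQ, R.1) = _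
    rw [← Set.sUnion_eq_iUnion]
    rfl
  unfold Cor312Setting.QCongruentSubHull
  rw [hU]
  exact ⟨fun ⟨R', hadm, hsub, hvol⟩ => ⟨R', hsub, hadm, hvol⟩, fun ⟨R', hsub, hadm, hvol⟩ => ⟨R', hadm, hsub, hvol⟩⟩

/-- **`IsoContainment` = Reading 4 at every component** (labels `j ∈ 𝔽_l^⋇` enumerated by `labelSucc`): TEAM A's
setting-level reading R4 of record is skel's `QCongruentSubHull` at every component container of the setting's nouns.
[claim: Mochizuki2012, status: disputed] -/
theorem isoContainment_iff_qCongruentSubHull_toPilotNouns (H : BridgeHyps P) (m : ℤ) :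
    Cor312Vol.IsoContainment P ↔
      ∀ (j : T.LabelStar) (vQ : T.VQ),
        (P.toPilotNouns.toCor312Setting P.n m j vQ (componentAdm_toPilotNouns_of_bridgeHyps H m j vQ)).QCongruentSubHull := by
  constructor
  · intro h j vQ
    rw [qCongruentSubHull_toPilotNouns_iff H m j vQ]
    obtain ⟨i, hi⟩ : ∃ i : Fin T.lstar, labelSucc i = j.1 := ⟨(succEquiv T).symm j, labelSucc_symm j⟩
    rw [← hi]
    exact h i vQ
  · intro h i vQ
    have := (qCongruentSubHull_toPilotNouns_iff H m ⟨labelSucc i, labelSucc_ne_zero i⟩ vQ).1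
      (h ⟨labelSucc i, labelSucc_ne_zero i⟩ vQ)
    exact this

/-- Hence `IsoContainment` gives the apex's aggregate route: Reading 4 at every component ⟹ skel's `Cor312` at every
component (`Cor312Setting.cor312_of_qCongruentSubHull`). [folklore] -/
theorem cor312_toPilotNouns_of_isoContainment (H : BridgeHyps P) (m : ℤ) (h : Cor312Vol.IsoContainment P)
    (j : T.LabelStar) (vQ : T.VQ) :
    (P.toPilotNouns.toCor312Setting P.n m j vQ (componentAdm_toPilotNouns_of_bridgeHyps H m j vQ)).Cor312 :=
  Cor312Setting.cor312_of_qCongruentSubHull _ ((isoContainment_iff_qCongruentSubHull_toPilotNouns H m).1 h j vQ)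

end Summit.ABC.IUTFork.Cor312.Setting

end
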